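import Summits.Parity.BatemanHorn.Theses.RoughValueTransport
import Literature.NumberTheory.LFunctions.PolynomialRootMoebiusRieszMean
import Literature.NumberTheory.Sieve.BatemanHornProofs
import HarnessLib

/-!
# Route `RoughValueTransport`, crux `RoughValueLaw` (stmt-Parity-11390), line `friable-deep-tail`:
# the registered stub `stub_rieszMeanRootMoebius` (S2b₁, k = 1)

`--supports` file of the checked skeleton
`Summits/Parity/BatemanHorn/Cruxes/RoughValueLaw/Lines/friable-deep-tail.lean` (v5).  It PROVES the
registered stub S2b₁ verbatim: for a Bateman–Horn system of ONE polynomial `f₀` the logarithmic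
Riesz mean `Σ_{m ≤ D} μ(m)ρ_{f₀}(m)/m · log(D/m)` converges as `D → ∞`
(`ρ_{f₀}(m) = #{r < m : m ∣ f₀(r)}`).  This is Landau's prime ideal theorem for `ℚ[X]/(f₀)` in
M-function / first-order-Riesz form, PROVED in the tree as
`Literature.NumberTheory.LFunctions.exists_tendsto_logRieszMean_moebius_rootCount_nat`
(file `Literature/NumberTheory/LFunctions/PolynomialRootMoebiusRieszMean.lean`); here only the
Bateman–Horn bookkeeping is added (`f₀` irreducible of positive degree:
`IsBatemanHornSystem.irreducible`, `IsBatemanHornSystem.natDegree_pos`; `polyRootCountMod ![f₀] m`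
is the displayed count).  In the line, the log-taper `w_D(d) = log(D/d)/log D` of the smoothed
Type-I sum makes its density part EXACTLY this Riesz mean (`typeISmoothLimit_of_parts`), so the
`k = 1` Type-I side of the crux's decomposition is closed by this file.
-/

noncomputable section

open Filter Finset Polynomial
open scoped Topology BigOperators
open Literature.NumberTheory.Sieve

namespace Summit.Parity.BatemanHorn.Cruxes.RoughValueLaw.FriableDeepTail

/-- **S2b₁ (registered stub of line `friable-deep-tail`, k = 1).**  For a Bateman–Horn system `f`
of one polynomial, `∃ L, Σ_{m ≤ D} μ(m)·#{r < m : m ∣ f₀(r)}/m · log(D/m) → L` (`D → ∞`).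
Landau's theorem (`exists_tendsto_logRieszMean_moebius_rootCount_nat`) applied to `f 0`, which is
irreducible of positive degree. [folklore] -/
theorem stub_rieszMeanRootMoebius :
    ∀ (f : Fin 1 → ℤ[X]), IsBatemanHornSystem f →
      ∃ L : ℝ, Tendsto (fun D : ℕ => ∑ m ∈ Icc 1 D,
        (ArithmeticFunction.moebius m : ℝ) *
          ((#((range m).filter (fun r : ℕ => ((m : ℕ) : ℤ) ∣ (f 0).eval (r : ℤ))) : ℕ) : ℝ) /
            (m : ℝ) * Real.log ((D : ℝ) / m)) atTop (𝓝 L) := by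
  intro f hf
  obtain ⟨L, hL⟩ := Literature.NumberTheory.LFunctions.exists_tendsto_logRieszMean_moebius_rootCount_nat
    (hf.irreducible 0) (hf.natDegree_pos 0)
  refine ⟨L, hL.congr fun D => Finset.sum_congr rfl fun m _ => ?_⟩
  rw [Literature.NumberTheory.LFunctions.polyRootCountMod_single_eq_card]

end Summit.Parity.BatemanHorn.Cruxes.RoughValueLaw.FriableDeepTail
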